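import Summits.NavierStokesRegularity.FluidComputer.RowCircuitEnd
import Summits.NavierStokesRegularity.FluidComputer.RowChainEnd
import HarnessLib

/-!
# The exact circuit: one-scale transfer with numbers (the `I(n) ⇒ I(n+1)` read-out for the pure
# circuit; `pub-fluidc-bp3/R1-DESIGN.md` §11.10)

HONEST FRAMING (cell `pub-fluidc`, blueprint seat bp3, gen 22): low prior, high value-of-information
experiment on Tao's machine paradigm; NOT a claim that NS blows up.

WHAT. `RowChain.circuit_transfer`: a hypothesis-free theorem about the 9-mode circuit
`ẏ = F gK ΛK y` started at the designed state `X0` (`a₁ ≥ 0.9961`, energy `≤ 1`): energy is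
conserved exactly and at some physical time `τ` the second gate's carrier holds `a₂(τ) ≥ 0.9636`
(so at least `92.8%` of the energy) while every coordinate obeys the caps `capQ` (the first gate's
residue `|b₁(τ)| ≤ 0.2563`, everything else `≤ 0.086`). It is `circuit_end` (`RowCircuitEnd.lean`:
layers T + A + A′ + R through `segAD`) read through the certified rational facts of
`RowChainEnd.lean` (`xh_ratCast` turns the reference polynomial's end value into `XENDQ`).
`end_readout` is the reusable real form of the end box; `circuit_transfer_from` is the same for any
admissible start (`circuit_end_from`).

[cite: Tao2016AveragedNS, §5.5 Thm 5.3 (5.5)]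
-/

noncomputable section

namespace Summit.NavierStokesRegularity.FluidComputer

open Literature.Analysis.FluidPDE.FluidComputer

namespace RowChain

open RowCheck RowCheck.RowData RowRun ChainField Set

/-- [folklore] -/
theorem XEND_eq (a : Fin 9) : XEND a = (XENDQ a : ℝ) :=
  xh_ratCast _ _ _

/-- [folklore] -/
theorem X0_eq (a : Fin 9) : X0 a = (X0Q a : ℝ) :=
  xh_zero _ _

/-- [folklore] -/
theorem EbarR_eq (r : RowData) (a : Fin 9) : r.EbarR a = ((r.Eb a : ℤ) : ℝ) / 2 ^ r.P :=
  rfl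

/-- **The end box in numbers**: any state within `Ē₁₀₆₅` of `XEND` has carrier `a₂ ≥ 0.9636` and
all coordinates under `capQ`. [folklore] -/
theorem end_readout (v : Fin 9 → ℝ) (hv : ∀ a, |v a - XEND a| ≤ (row 1065).EbarR a) :
    (2409 : ℝ) / 2500 ≤ v 4 ∧ ∀ a, |v a| ≤ (capQ a : ℝ) := by
  obtain ⟨h4, hcap⟩ := end_readoutQ
  constructor
  · have h := hv 4
    rw [XEND_eq, EbarR_eq] at h
    have h4' : (((2409 : ℚ) / 2500 : ℚ) : ℝ) ≤
        ((XENDQ 4 - ((row 1065).Eb 4 : ℚ) / 2 ^ (row 1065).P : ℚ) : ℝ) := by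
      exact_mod_cast h4
    push_cast at h4'
    have := (abs_sub_le_iff.1 h).2
    linarith
  · intro a
    have h := hv a
    rw [XEND_eq, EbarR_eq] at h
    have hc : ((|XENDQ a| + ((row 1065).Eb a : ℚ) / 2 ^ (row 1065).P : ℚ) : ℝ) ≤
        (capQ a : ℝ) := by
      exact_mod_cast hcap a
    push_cast at hc
    calc |v a| = |(v a - (XENDQ a : ℝ)) + XENDQ a| := by rw [sub_add_cancel]
      _ ≤ |v a - XENDQ a| + |(XENDQ a : ℝ)| := abs_add_le _ _
      _ ≤ _ := by linarith

/-- **The start in numbers**: `X0` is locked on `b₁`, has `a₁ ≥ 0.9961` and energy `≤ 1`.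
[folklore] -/
theorem start_readout : (row 0).p = 1 ∧ (9961 : ℝ) / 10000 ≤ X0 0 ∧ ∑ a, X0 a ^ 2 ≤ 1 := by
  obtain ⟨hp, h0, hE⟩ := start_readoutQ
  refine ⟨hp, ?_, ?_⟩
  · rw [X0_eq]
    have h0' : (((9961 : ℚ) / 10000 : ℚ) : ℝ) ≤ (X0Q 0 : ℝ) := by exact_mod_cast h0
    push_cast at h0'
    exact h0'
  · simp_rw [X0_eq]
    exact_mod_cast hE

/-- Energy is conserved exactly along any solution of the circuit. [folklore] -/
theorem energy_conserved {y : ℝ → Fin 9 → ℝ} (hsol : ∀ σ, HasDerivAt y (F gK ΛK (y σ)) σ)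
    (τ : ℝ) : ∑ a, y τ a ^ 2 = ∑ a, y 0 a ^ 2 := by
  rcases le_total 0 τ with hτ | hτ
  · exact CircuitFlow.sum_sq_eq (energy gK ΛK) (a := 0) (s := τ)
      (fun t _ => (hsol t).hasDerivWithinAt) τ ⟨hτ, le_rfl⟩
  · exact (CircuitFlow.sum_sq_eq (energy gK ΛK) (a := τ) (s := 0)
      (fun t _ => (hsol t).hasDerivWithinAt) 0 ⟨hτ, le_rfl⟩).symm

/-- **One-scale transfer, from any admissible start, in numbers.** [folklore] -/
theorem circuit_transfer_from (q₀ : Fin 9 → ℝ) (hlock : q₀ (row 0).p = X0 (row 0).p)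
    (hbox : ∀ i, |z0 q₀ i| ≤ (row 0).ubR 0 i) :
    ∃ y : ℝ → Fin 9 → ℝ, y 0 = q₀ ∧ (∀ σ, HasDerivAt y (F gK ΛK (y σ)) σ) ∧
      (∀ τ, ∑ a, y τ a ^ 2 = ∑ a, q₀ a ^ 2) ∧
      ∃ τ : ℝ, (2409 : ℝ) / 2500 ≤ y τ 4 ∧ ∀ a, |y τ a| ≤ (capQ a : ℝ) := by
  obtain ⟨y, hy0, hsol, τ, hτ⟩ := circuit_end_from q₀ hlock hbox
  exact ⟨y, hy0, hsol, fun τ => hy0 ▸ energy_conserved hsol τ, τ, end_readout (y τ) hτ⟩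

/-- **One-scale transfer (`I(n) ⇒ I(n+1)` for the exact circuit).** The circuit started at the
designed state `X0` — lock `b₁ = X0 b₁`, carrier `a₁(0) ≥ 0.9961`, energy `≤ 1` — conserves
energy exactly and reaches a physical time `τ` at which the NEXT carrier holds `a₂(τ) ≥ 0.9636`
and every coordinate is capped by `capQ` (`|b₁(τ)| ≤ 0.2563`, all others `≤ 0.086`). [folklore] -/
theorem circuit_transfer :
    (9961 : ℝ) / 10000 ≤ X0 0 ∧ ∑ a, X0 a ^ 2 ≤ 1 ∧
    ∃ y : ℝ → Fin 9 → ℝ, y 0 = X0 ∧ (∀ σ, HasDerivAt y (F gK ΛK (y σ)) σ) ∧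
      (∀ τ, ∑ a, y τ a ^ 2 = ∑ a, X0 a ^ 2) ∧
      ∃ τ : ℝ, (2409 : ℝ) / 2500 ≤ y τ 4 ∧ ∀ a, |y τ a| ≤ (capQ a : ℝ) :=
  ⟨start_readout.2.1, start_readout.2.2,
    circuit_transfer_from X0 rfl fun i => by
      rw [z0_X0, abs_zero]; exact ubR_zero_nonneg_row 0 i⟩

end RowChain

end Summit.NavierStokesRegularity.FluidComputer
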